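import Summits.QuantumFields.BalabanUV.Beta.EriceFlowEnclosureLogScalePowerScalesClock

/-!
# Beta / EriceFlowEnclosureLogScalePowerScalesNormalisation — THE POWER-SCALE CLASS DOES NOT SEE ITS NORMALISATION (gen 38 OPEN (c); P2 #55f's
# «NOT CLAIMED: independence of the normalisation … true up to shrinking λ, not filed» FILED): for ANY real function M and any two
# normalisations `c, c′ > 0`, **M is slowly decreasing on the power scales at 0⁺ normalised at c ⟺ normalised at c′** — with `λ = c∕c′` the scales
# `y′ ↦ y = λy′` correspond (`c′∕y′ = c∕y`), and the window `y′ < u′ ≤ y′^{l′}` maps INTO `y < u ≤ y^{l}` as soon as the exponent is SHRUNK to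
# `l′ = (1 + l)∕2` and `y′ ≥ λ⁻²` (`λ·y′^{l′} ≤ (λy′)^{l} ⟺ (λ²y′)^{(l−1)∕2} ≥ 1`).  No continuity, no log-Lipschitz bound, no δ.  Consequences BY
# NAME: P2 #55d's Tauberian theorem and its «necessary and sufficient» form with the class normalised ANYWHERE (not at the c < δ of the average),
# P2 #55f's «function class ⟺ sample class along any clock» with the function class at any c > 0 and the clock at any L₀ > 0, and — new — THE
# SAMPLE CLASS DOES NOT SEE THE CLOCK CONSTANT EITHER: for log-Lipschitz M the samples along a clock with constant L₀ are in P2 #54i's class iff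
# the samples along a clock with constant L₀′ are.
#   §1 `powerScaleSD_shrink` (the exponent may always be shrunk), `window_transport` (the rpow inequality), HEADLINE **`powerScaleSD_renormalise`**,
#      END **`powerScaleSD_iff_renormalise`**;
#   §2 BY NAME: `tendsto_of_logScaleAverage_powerScaleSD_at`, `tendsto_iff_logScaleAverage_and_powerScaleSD_at` (P2 #55d at any normalisation),
#      `powerScaleSD_function_iff_samples_clock_at` (P2 #55f at any normalisation and any clock), END **`samples_powerScaleSD_clockConstant_transfer`**.
# (β-flow team, prover 2 = lower ∕ positivity side, unit `b2b-balaban-beta-bflow-p2`, gen 39; module P2 #56c; pure [folklore]; no Erice sentence)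

HONEST FRAMING (page 1 of everything the β sub-cell writes): discharging `BetaPertH` makes Bałaban's UV stability UNCONDITIONAL — a
real constructive-QFT result; it is NOT the continuum limit and NOT the Clay problem.  HONEST DEPENDENCY (cell reorg 2026-08-19,
verbatim): «continuum YM on T⁴ ⇐ BetaPertH ∧ nine spine estimates (0/9 proved); BetaPertH ⇐ (D1) ∧ (D4) ∧ CAP+tail; G-an2-4 gates
asym, D1 and NE2/3/4.»  THIS MODULE DISCHARGES NOTHING and quotes nothing: [folklore] bookkeeping on Móricz's power-scale slow-decrease
condition (shape: M = the three-loop Cesàro mean).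

WHAT THIS FILE PROVES (0 sorry, 0 def): §1 `powerScaleSD_shrink`, `window_transport`, HEADLINE **`powerScaleSD_renormalise`**, END
**`powerScaleSD_iff_renormalise`**; §2 `tendsto_of_logScaleAverage_powerScaleSD_at`, `tendsto_iff_logScaleAverage_and_powerScaleSD_at`,
`powerScaleSD_function_iff_samples_clock_at`, END **`samples_powerScaleSD_clockConstant_transfer`**.
NOT CLAIMED: anything on (3.62) ∕ β (the class is nowhere supplied for a β-flow datum); `BetaPertH`; continuum; Clay.
-/

namespace Summit.QuantumFields.BalabanUV.Beta.EriceFlowEnclosureLogScalePowerScalesNormalisation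

open Set Filter Topology MeasureTheory intervalIntegral
open Summit.QuantumFields.BalabanUV.Beta.EriceFlowEnclosureLogScalePowerScales
  (tendsto_of_logScaleAverage_powerScaleSlowlyDecreasing tendsto_iff_logScaleAverage_and_powerScaleSD)
open Summit.QuantumFields.BalabanUV.Beta.EriceFlowEnclosureLogScalePowerScalesClock (powerScaleSD_function_iff_samples_clock)

noncomputable section

variable {M : ℝ → ℝ} {δ C L₀ : ℝ}

/-! ## §1 Renormalising the class -/

/-- THE EXPONENT MAY ALWAYS BE SHRUNK: a window certificate `(y₀, l)` is also one for every `1 < l′ ≤ l` (for `y ≥ 1`, `y^{l′} ≤ y^{l}`). [folklore] -/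
theorem powerScaleSD_shrink {c ε y₀ l l' : ℝ} (hy₀ : 1 < y₀) (hl'l : l' ≤ l)
    (h : ∀ y u : ℝ, y₀ ≤ y → y < u → u ≤ y ^ l → -ε ≤ M (c / u) - M (c / y)) :
    ∀ y u : ℝ, y₀ ≤ y → y < u → u ≤ y ^ l' → -ε ≤ M (c / u) - M (c / y) :=
  fun y u hy hyu hul' => h y u hy hyu (hul'.trans (Real.rpow_le_rpow_of_exponent_le (le_trans hy₀.le hy) hl'l))

/-- **THE WINDOW TRANSPORT**: for `λ > 0`, `1 < l`, `l′ = (1 + l)∕2`, `y′ ≥ 1` with `λ²·y′ ≥ 1`: **`λ·y′^{l′} ≤ (λ·y′)^{l}`**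
(`(λy′)^{l} = λ·y′^{l′}·(λ²y′)^{(l−1)∕2}` and the last factor is ≥ 1). [folklore] -/
theorem window_transport {lam l y' : ℝ} (hlam : 0 < lam) (hl : 1 < l) (hy' : 1 ≤ y') (hly : 1 ≤ lam ^ 2 * y') :
    lam * y' ^ ((1 + l) / 2) ≤ (lam * y') ^ l := by
  have hy'0 : 0 < y' := lt_of_lt_of_le one_pos hy'
  have hη : 0 ≤ (l - 1) / 2 := by linarith
  -- (λ y')^l = λ^l y'^l, λ^l = λ · (λ²)^{(l-1)/2}, y'^l = y'^{(1+l)/2} · y'^{(l-1)/2}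
  have hlam_l : lam ^ l = lam * (lam ^ 2) ^ ((l - 1) / 2) := by
    have h2 : (lam ^ 2) ^ ((l - 1) / 2) = lam ^ (2 * ((l - 1) / 2)) := by
      rw [Real.rpow_mul hlam.le, Real.rpow_two]
    rw [h2, show 2 * ((l - 1) / 2) = l - 1 by ring]
    conv_lhs => rw [show l = 1 + (l - 1) by ring, Real.rpow_add hlam, Real.rpow_one]
  have hy_l : y' ^ l = y' ^ ((1 + l) / 2) * y' ^ ((l - 1) / 2) := by
    rw [← Real.rpow_add hy'0]; congr 1; ring
  rw [Real.mul_rpow hlam.le hy'0.le, hlam_l, hy_l]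
  have hfac : 1 ≤ (lam ^ 2) ^ ((l - 1) / 2) * y' ^ ((l - 1) / 2) := by
    rw [← Real.mul_rpow (sq_nonneg lam) hy'0.le]
    exact Real.one_le_rpow hly hη
  have hpos : 0 ≤ lam * y' ^ ((1 + l) / 2) := by positivity
  calc lam * y' ^ ((1 + l) / 2) = lam * y' ^ ((1 + l) / 2) * 1 := (mul_one _).symm
    _ ≤ lam * y' ^ ((1 + l) / 2) * ((lam ^ 2) ^ ((l - 1) / 2) * y' ^ ((l - 1) / 2)) :=
        mul_le_mul_of_nonneg_left hfac hpos
    _ = lam * (lam ^ 2) ^ ((l - 1) / 2) * (y' ^ ((1 + l) / 2) * y' ^ ((l - 1) / 2)) := by ring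

/-- **HEADLINE — THE POWER-SCALE CLASS DOES NOT SEE ITS NORMALISATION.**  For ANY `M : ℝ → ℝ` and `c, c′ > 0`: if M is slowly decreasing on the
power scales at 0⁺ normalised at c (`∀ ε > 0 ∃ y₀ > 1, l > 1: −ε ≤ M(c∕u) − M(c∕y)` whenever `y₀ ≤ y < u ≤ y^{l}`) then also normalised at c′ —
with certificate `(max(y₀∕λ, λ⁻², 2), (1 + l)∕2)`, `λ = c∕c′` (`y = λy′`, `u = λu′`, §1 `window_transport`). [folklore] -/
theorem powerScaleSD_renormalise {c c' : ℝ} (hc : 0 < c) (hc' : 0 < c')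
    (hsd : ∀ ε : ℝ, 0 < ε → ∃ (y₀ l : ℝ), 1 < y₀ ∧ 1 < l ∧
      ∀ y u : ℝ, y₀ ≤ y → y < u → u ≤ y ^ l → -ε ≤ M (c / u) - M (c / y)) :
    ∀ ε : ℝ, 0 < ε → ∃ (y₀ l : ℝ), 1 < y₀ ∧ 1 < l ∧
      ∀ y u : ℝ, y₀ ≤ y → y < u → u ≤ y ^ l → -ε ≤ M (c' / u) - M (c' / y) := by
  intro ε hε
  obtain ⟨y₀, l, hy₀, hl, h⟩ := hsd ε hε
  set lam : ℝ := c / c' with hlam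
  have hlam0 : 0 < lam := div_pos hc hc'
  refine ⟨max (max (y₀ / lam) (lam ^ 2)⁻¹) 2, (1 + l) / 2, by linarith [le_max_right (max (y₀ / lam) (lam ^ 2)⁻¹) (2:ℝ)],
    by linarith, fun y' u' hy' hyu' hul' => ?_⟩
  have hy'1 : 1 ≤ y' := by linarith [le_max_right (max (y₀ / lam) (lam ^ 2)⁻¹) (2:ℝ)]
  have hy'0 : 0 < y' := lt_of_lt_of_le one_pos hy'1
  have hu'0 : 0 < u' := hy'0.trans hyu'
  have hy₀' : y₀ / lam ≤ y' := le_trans (le_trans (le_max_left _ _) (le_max_left _ _)) hy'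
  have hlam2 : (lam ^ 2)⁻¹ ≤ y' := le_trans (le_trans (le_max_right _ _) (le_max_left _ _)) hy'
  have hly : 1 ≤ lam ^ 2 * y' := by
    have h2 : 0 < lam ^ 2 := by positivity
    calc (1:ℝ) = lam ^ 2 * (lam ^ 2)⁻¹ := by field_simp
      _ ≤ lam ^ 2 * y' := mul_le_mul_of_nonneg_left hlam2 h2.le
  -- the transported scales
  have hy : y₀ ≤ lam * y' := by rw [div_le_iff₀ hlam0] at hy₀'; linarith
  have hyu : lam * y' < lam * u' := mul_lt_mul_of_pos_left hyu' hlam0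
  have hul : lam * u' ≤ (lam * y') ^ l :=
    le_trans (mul_le_mul_of_nonneg_left hul' hlam0.le) (window_transport hlam0 hl hy'1 hly)
  have hmain := h (lam * y') (lam * u') hy hyu hul
  have hcu : c / (lam * u') = c' / u' := by rw [hlam]; field_simp
  have hcy : c / (lam * y') = c' / y' := by rw [hlam]; field_simp
  rwa [hcu, hcy] at hmain

/-- **END — ONE CLASS FOR ALL NORMALISATIONS**: for any M and `c, c′ > 0`, M is slowly decreasing on the power scales at 0⁺ normalised at c
**iff** normalised at c′. [folklore] -/
theorem powerScaleSD_iff_renormalise {c c' : ℝ} (hc : 0 < c) (hc' : 0 < c') :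
    (∀ ε : ℝ, 0 < ε → ∃ (y₀ l : ℝ), 1 < y₀ ∧ 1 < l ∧
        ∀ y u : ℝ, y₀ ≤ y → y < u → u ≤ y ^ l → -ε ≤ M (c / u) - M (c / y)) ↔
      (∀ ε : ℝ, 0 < ε → ∃ (y₀ l : ℝ), 1 < y₀ ∧ 1 < l ∧
        ∀ y u : ℝ, y₀ ≤ y → y < u → u ≤ y ^ l → -ε ≤ M (c' / u) - M (c' / y)) :=
  ⟨powerScaleSD_renormalise hc hc', powerScaleSD_renormalise hc' hc⟩

/-! ## §2 By name: the Tauberian theorem and the clock transport at any normalisation -/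

/-- **MÓRICZ COR. 1 AT 0⁺ WITH THE CLASS NORMALISED ANYWHERE**: M continuous on ]0, δ[, `0 < c < δ`, M slowly decreasing on the power scales at
0⁺ normalised at SOME `c′ > 0` (possibly ≥ δ), and `(∫_h^c M ds∕s)∕log(c∕h) → m` at 0⁺ ⟹ `M → m` at 0⁺ (P2 #55d + §1). [folklore] over the
proved fact `Moricz2013_corollary1_holds`. -/
theorem tendsto_of_logScaleAverage_powerScaleSD_at (hcont : ContinuousOn M (Ioo 0 δ)) {c : ℝ} (hc0 : 0 < c) (hcδ : c < δ)
    {c' : ℝ} (hc' : 0 < c')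
    (hsd : ∀ ε : ℝ, 0 < ε → ∃ (y₀ l : ℝ), 1 < y₀ ∧ 1 < l ∧
      ∀ y u : ℝ, y₀ ≤ y → y < u → u ≤ y ^ l → -ε ≤ M (c' / u) - M (c' / y))
    {m : ℝ} (havg : Tendsto (fun h => (∫ s in h..c, M s / s) / Real.log (c / h)) (𝓝[>] 0) (𝓝 m)) :
    Tendsto M (𝓝[>] 0) (𝓝 m) :=
  tendsto_of_logScaleAverage_powerScaleSlowlyDecreasing hcont hc0 hcδ (powerScaleSD_renormalise hc' hc0 hsd) havg

/-- **NECESSARY AND SUFFICIENT, NORMALISED ANYWHERE**: M continuous on ]0, δ[, `0 < c < δ`, `c′ > 0`; for every m: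
**`M → m` at 0⁺ ⟺ (log-scale average at c → m at 0⁺ ∧ M slowly decreasing on the power scales normalised at c′)** (P2 #55d v1.1 + §1). [folklore] -/
theorem tendsto_iff_logScaleAverage_and_powerScaleSD_at (hcont : ContinuousOn M (Ioo 0 δ)) {c : ℝ} (hc0 : 0 < c) (hcδ : c < δ)
    {c' : ℝ} (hc' : 0 < c') (m : ℝ) :
    Tendsto M (𝓝[>] 0) (𝓝 m) ↔
      (Tendsto (fun h => (∫ s in h..c, M s / s) / Real.log (c / h)) (𝓝[>] 0) (𝓝 m) ∧
        ∀ ε : ℝ, 0 < ε → ∃ (y₀ l : ℝ), 1 < y₀ ∧ 1 < l ∧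
          ∀ y u : ℝ, y₀ ≤ y → y < u → u ≤ y ^ l → -ε ≤ M (c' / u) - M (c' / y)) := by
  rw [tendsto_iff_logScaleAverage_and_powerScaleSD hcont hc0 hcδ m, powerScaleSD_iff_renormalise (M := M) hc0 hc']

/-- **THE CLOCK TRANSPORT AT ANY NORMALISATION**: M C-log-Lipschitz on ]0, δ[ (C ≥ 0), `h_n > 0` with `n·h_n → L₀ > 0`, and ANY `c > 0`:
**M is slowly decreasing on the power scales at 0⁺ normalised at c ⟺ the samples `M(h_n)` are slowly decreasing on the power scales**
(P2 #55f `powerScaleSD_function_iff_samples_clock` at L₀ + §1 between c and L₀). [folklore] -/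
theorem powerScaleSD_function_iff_samples_clock_at (hδ : 0 < δ) (hL₀ : 0 < L₀) (hC : 0 ≤ C)
    (hlip : ∀ t u : ℝ, 0 < t → t ≤ u → u < δ → |M u - M t| ≤ C * Real.log (u / t))
    {h : ℕ → ℝ} (hpos : ∀ n, 0 < h n) (hclock : Tendsto (fun n : ℕ => (n : ℝ) * h n) atTop (𝓝 L₀))
    {c : ℝ} (hc : 0 < c) :
    (∀ ε : ℝ, 0 < ε → ∃ (y₀ l : ℝ), 1 < y₀ ∧ 1 < l ∧
        ∀ y u : ℝ, y₀ ≤ y → y < u → u ≤ y ^ l → -ε ≤ M (c / u) - M (c / y)) ↔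
      (∀ ε : ℝ, 0 < ε → ∃ (N₀ : ℕ) (l : ℝ), 1 < l ∧
        ∀ N i : ℕ, N₀ ≤ N → N < i → (i : ℝ) + 1 ≤ ((N : ℝ) + 1) ^ l → -ε ≤ M (h i) - M (h N)) := by
  rw [powerScaleSD_iff_renormalise (M := M) hc hL₀]
  exact powerScaleSD_function_iff_samples_clock hδ hL₀ hC hlip hpos hclock

/-- **END — THE SAMPLE CLASS DOES NOT SEE THE CLOCK CONSTANT**: M C-log-Lipschitz on ]0, δ[ (C ≥ 0), two positive clocks with POSSIBLY DIFFERENT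
constants `n·h_n → L₀ > 0`, `n·h′_n → L₀′ > 0`.  If the samples `M(h_n)` are slowly decreasing on the power scales, so are the samples `M(h′_n)`
(through the function class: at L₀ by P2 #55f, = at L₀′ by §1, back to the samples along h′ by P2 #55f).  P2 #55f `samples_powerScaleSD_clock_transfer`
is the case L₀ = L₀′. [folklore] -/
theorem samples_powerScaleSD_clockConstant_transfer (hδ : 0 < δ) (hC : 0 ≤ C)
    (hlip : ∀ t u : ℝ, 0 < t → t ≤ u → u < δ → |M u - M t| ≤ C * Real.log (u / t))
    {h h' : ℕ → ℝ} (hpos : ∀ n, 0 < h n) (hpos' : ∀ n, 0 < h' n) {L₀' : ℝ} (hL₀ : 0 < L₀) (hL₀' : 0 < L₀')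
    (hclock : Tendsto (fun n : ℕ => (n : ℝ) * h n) atTop (𝓝 L₀))
    (hclock' : Tendsto (fun n : ℕ => (n : ℝ) * h' n) atTop (𝓝 L₀'))
    (hsd : ∀ ε : ℝ, 0 < ε → ∃ (N₀ : ℕ) (l : ℝ), 1 < l ∧
      ∀ N i : ℕ, N₀ ≤ N → N < i → (i : ℝ) + 1 ≤ ((N : ℝ) + 1) ^ l → -ε ≤ M (h i) - M (h N)) :
    ∀ ε : ℝ, 0 < ε → ∃ (N₀ : ℕ) (l : ℝ), 1 < l ∧
      ∀ N i : ℕ, N₀ ≤ N → N < i → (i : ℝ) + 1 ≤ ((N : ℝ) + 1) ^ l → -ε ≤ M (h' i) - M (h' N) := by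
  have hfun := (powerScaleSD_function_iff_samples_clock hδ hL₀ hC hlip hpos hclock).mpr hsd
  exact (powerScaleSD_function_iff_samples_clock_at hδ hL₀' hC hlip hpos' hclock' hL₀).mp hfun

end

end Summit.QuantumFields.BalabanUV.Beta.EriceFlowEnclosureLogScalePowerScalesNormalisation
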